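import Literature.NumberTheory.BeurlingPrimes.BeurlingIntegers
import Literature.NumberTheory.LFunctions.RieszKernelTwo
import HarnessLib

/-!
# Cesàro-smoothed partial sums of `ζ_P` and their Perron integral (order-two kernel)

Topic `Literature/NumberTheory/BeurlingPrimes`. Everything in this file is PROVED.

For a Beurling prime system `P` and `N > 0` let
`F_N(s) = ∑_{n ∈ 𝒩, n ≤ N} n^{−s} (1 − n/N)²` (`smoothedZeta`, a finite generalized Dirichlet
polynomial over the g-integers, counted with multiplicity). By the order-two Riesz kernel
`(1/2πi)∫_{(c)} y^{−w} 2dw/(w(w+1)(w+2)) = ((1−y)⁺)²` (tree, `mellinInv_rieszKernel₂_eq`,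
`RieszKernelTwo.lean`) and Fubini (the double sum/integral converging absolutely as soon as
`∑ n^{−(Re s + c)} < ∞`):

  `F_N(s) = (1/2π) ∫_{−∞}^{∞} ζ_P(s + c + iu) N^{c+iu} · 2du/((c+iu)(c+1+iu)(c+2+iu))`   (`c > 0`),

i.e. `F_N(s) = (1/2πi)∫_{(c)} ζ_P(s+w) N^w 2dw/(w(w+1)(w+2))` (`smoothedZeta_eq_integral`). This is
Perron's formula in the Cesàro normalisation of Montgomery–Vaughan §5.1 (5.19) with `k = 2`, for the
generalized Dirichlet series `ζ_P` (the order-one case for the counting function is the tree's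
`BeurlingPrimes.rieszInt_eq_integral`, `BeurlingIntegers.lean`). The smoothing is what replaces
Hilberdink's truncated Perron formula for the sharp partial sums `ζ_N(s)` (JNT 2005, proof of Thm. 1;
JNT 2007, (4)), whose error terms require a gap around `N` free of g-integers.

## References
* [MontgomeryVaughan2007] H. L. Montgomery, R. C. Vaughan, *Multiplicative Number Theory I*, §5.1 (5.19).
* [Hilberdink2007] T. W. Hilberdink, J. Number Theory 122 (2007) 336–341, proof of Thm. 1, (4) (read).
-/

noncomputable section

open Complex Filter Set MeasureTheory Real

namespace Literature.NumberTheory.BeurlingPrimes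

open Literature.Barriers.RiemannHypothesis Literature.NumberTheory.LFunctions

variable (P : BeurlingPrimes)

/-- The order-two Riesz kernel `K₂(w) = 2/(w(w+1)(w+2))`. [cite: MontgomeryVaughan2007, §5.1 (5.19)] -/
def rieszKernel₂ (w : ℂ) : ℂ := 2 / (w * (w + 1) * (w + 2))

/-- **`F_N(s) = ∑_{n ∈ 𝒩, n ≤ N} n^{−s}(1 − n/N)²`**, the Cesàro-smoothed partial sums of `ζ_P`
(finite sum over the exponent vectors `k` with `genInt k ≤ N`). [cite: Hilberdink2007, proof of Thm 1] -/
def _root_.Literature.Barriers.RiemannHypothesis.BeurlingPrimes.smoothedZeta (N : ℝ) (s : ℂ) : ℂ :=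
  ∑ k ∈ Hilberdink.intFinset P N,
    ((P.genInt k : ℝ) : ℂ) ^ (-s) * ((((1 - P.genInt k / N) ^ 2 : ℝ)) : ℂ)

variable {P}

/-- `F_N(s)` as a sum over ALL g-integers with the weight `((1 − n/N)⁺)²`. [folklore] -/
theorem smoothedZeta_eq_tsum {N : ℝ} (hN : 0 < N) (s : ℂ) :
    P.smoothedZeta N s =
      ∑' k : ℕ →₀ ℕ, ((P.genInt k : ℝ) : ℂ) ^ (-s) * ((((max (1 - P.genInt k / N) 0) ^ 2 : ℝ)) : ℂ) := by
  rw [BeurlingPrimes.smoothedZeta, tsum_eq_sum (s := Hilberdink.intFinset P N)]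
  · refine Finset.sum_congr rfl fun k hk ↦ ?_
    rw [Hilberdink.mem_intFinset] at hk
    rw [max_eq_left]
    rw [sub_nonneg, div_le_one hN]
    exact hk
  · intro k hk
    rw [Hilberdink.mem_intFinset, not_le] at hk
    rw [max_eq_right]
    · simp
    · rw [sub_nonpos, one_le_div hN]
      exact hk.le

/-- One term: for `g, N, c > 0`,
`((1 − g/N)⁺)² = (1/2π) ∫ (g/N)^{−(c+iu)} K₂(c+iu) du` (the kernel evaluation at `y = g/N`).
[cite: MontgomeryVaughan2007, §5.1 (5.19)] -/
theorem posPart_sq_eq_integral {g N c : ℝ} (hg : 0 < g) (hN : 0 < N) (hc : 0 < c) :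
    ((((max (1 - g / N) 0) ^ 2 : ℝ)) : ℂ) = (1 / (2 * π) : ℂ) *
      ∫ u : ℝ, (((g / N : ℝ)) : ℂ) ^ (-((c : ℂ) + u * I)) * rieszKernel₂ ((c : ℂ) + u * I) := by
  have hK := mellinInv_rieszKernel₂_eq hc (div_pos hg hN)
  unfold mellinInv at hK
  rw [← hK, Complex.real_smul]
  push_cast
  congr 1

/-- **Perron's formula (Cesàro, order two) for `ζ_P`**: for `N > 0`, `c > 0` and `s` with
`∑_n n^{−(Re s + c)} < ∞`,
`F_N(s) = (1/2π) ∫ ζ_P(s + c + iu) N^{c+iu} K₂(c + iu) du`. [cite: MontgomeryVaughan2007, §5.1 (5.19)] -/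
theorem smoothedZeta_eq_integral {N : ℝ} (hN : 0 < N) {c : ℝ} (hc : 0 < c) {s : ℂ}
    (hsum : Summable fun k : ℕ →₀ ℕ ↦ P.genInt k ^ (-(s.re + c))) :
    P.smoothedZeta N s = (1 / (2 * π) : ℂ) * ∫ u : ℝ,
      P.zeta (s + ((c : ℂ) + u * I)) * (N : ℂ) ^ ((c : ℂ) + u * I) * rieszKernel₂ ((c : ℂ) + u * I) := by
  set K : ℝ → ℂ := fun u ↦ rieszKernel₂ ((c : ℂ) + u * I) with hKdef
  set F : (ℕ →₀ ℕ) → ℝ → ℂ := fun k u ↦ ((P.genInt k : ℝ) : ℂ) ^ (-s) *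
    ((((P.genInt k / N : ℝ)) : ℂ) ^ (-((c : ℂ) + u * I)) * K u) with hF
  have hintK : Integrable K := by
    have := integrable_rieszKernel₂ hc
    exact this.congr (Eventually.of_forall fun u ↦ by simp [hKdef, rieszKernel₂])
  have hnorm : ∀ k u, ‖F k u‖ = P.genInt k ^ (-(s.re + c)) * N ^ c * ‖K u‖ := by
    intro k u
    have hg := P.genInt_pos k
    simp only [hF, norm_mul]
    rw [norm_cpow_eq_rpow_re_of_pos hg, norm_cpow_eq_rpow_re_of_pos (div_pos hg hN),
      Real.div_rpow hg.le hN.le]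
    simp only [neg_re, add_re, ofReal_re, mul_re, I_re, mul_zero, ofReal_im, I_im, mul_one,
      sub_self, add_zero]
    rw [Real.rpow_neg hN.le, neg_add, Real.rpow_add hg]
    field_simp
  have hcont : ∀ k, Continuous fun u : ℝ ↦ ((P.genInt k : ℝ) : ℂ) ^ (-s) *
      (((P.genInt k / N : ℝ)) : ℂ) ^ (-((c : ℂ) + u * I)) := by
    intro k
    refine continuous_const.mul ?_
    exact Continuous.const_cpow (by fun_prop)
      (Or.inl (ofReal_ne_zero.mpr (div_pos (P.genInt_pos k) hN).ne'))
  have hintF : ∀ k, Integrable (F k) := by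
    intro k
    have h := hintK.bdd_mul (c := P.genInt k ^ (-(s.re + c)) * N ^ c) (hcont k).aestronglyMeasurable
      (Eventually.of_forall fun u ↦ ?_)
    · refine h.congr (Eventually.of_forall fun u ↦ ?_)
      simp only [hF]; ring
    · have := hnorm k u
      simp only [hF, norm_mul] at this ⊢
      have hK0 : 0 ≤ ‖K u‖ := norm_nonneg _
      rcases hK0.lt_or_eq with hpos | hzero
      · have := this
        nlinarith [norm_nonneg (((P.genInt k : ℝ) : ℂ) ^ (-s)),
          norm_nonneg ((((P.genInt k / N : ℝ)) : ℂ) ^ (-((c : ℂ) + u * I)))]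
      · rw [norm_cpow_eq_rpow_re_of_pos (P.genInt_pos k),
          norm_cpow_eq_rpow_re_of_pos (div_pos (P.genInt_pos k) hN), Real.div_rpow (P.genInt_pos k).le hN.le]
        simp only [neg_re, add_re, ofReal_re, mul_re, I_re, mul_zero, ofReal_im, I_im, mul_one,
          sub_self, add_zero]
        rw [Real.rpow_neg hN.le, neg_add, Real.rpow_add (P.genInt_pos k)]
        apply le_of_eq; field_simp
  have hsumF : Summable fun k ↦ ∫ u, ‖F k u‖ := by
    have := (hsum.mul_right (N ^ c)).mul_right (∫ u : ℝ, ‖K u‖)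
    refine this.congr fun k ↦ ?_
    rw [← integral_const_mul]
    exact integral_congr_ae (Eventually.of_forall fun u ↦ (hnorm k u).symm)
  have hterm : ∀ k : ℕ →₀ ℕ, ((P.genInt k : ℝ) : ℂ) ^ (-s) *
      ((((max (1 - P.genInt k / N) 0) ^ 2 : ℝ)) : ℂ) = (1 / (2 * π) : ℂ) * ∫ u, F k u := by
    intro k
    rw [posPart_sq_eq_integral (P.genInt_pos k) hN hc, ← mul_assoc, mul_comm _ (1 / (2 * π) : ℂ),
      mul_assoc, ← integral_const_mul]
  rw [smoothedZeta_eq_tsum hN, tsum_congr hterm, tsum_mul_left,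
    integral_tsum_of_summable_integral_norm hintF hsumF]
  congr 1
  refine integral_congr_ae (Eventually.of_forall fun u ↦ ?_)
  simp only [hF, hKdef]
  rw [BeurlingPrimes.zeta, ← tsum_mul_right, ← tsum_mul_right]
  refine tsum_congr fun k ↦ ?_
  have hg := P.genInt_pos k
  have hg0 : ((P.genInt k : ℝ) : ℂ) ≠ 0 := ofReal_ne_zero.mpr hg.ne'
  have e1 : ((((P.genInt k / N : ℝ)) : ℂ)) ^ (-((c : ℂ) + u * I)) =
      ((P.genInt k : ℝ) : ℂ) ^ (-((c : ℂ) + u * I)) * (N : ℂ) ^ ((c : ℂ) + u * I) := by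
    rw [ofReal_div_cpow hg hN, neg_neg]
  have e2 : ((P.genInt k : ℝ) : ℂ) ^ (-(s + ((c : ℂ) + u * I))) =
      ((P.genInt k : ℝ) : ℂ) ^ (-s) * ((P.genInt k : ℝ) : ℂ) ^ (-((c : ℂ) + u * I)) := by
    rw [neg_add, cpow_add _ _ hg0]
  rw [e1, e2]
  ring

end Literature.NumberTheory.BeurlingPrimes

end
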